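import Summits.HodgeConjecture.HodgeConjecture.Theorems.Ring2WeilCoverageRealUnitNormHalfSystems
import Mathlib.RingTheory.ZMod.UnitsCyclic
import Mathlib.RingTheory.RootsOfUnity.CyclotomicUnits
import HarnessLib

/-!
# Weil-type family coverage — THE CONVERSE OF THEOREM L (i) AT THE CYCLIC LEVELS `4`, `p^a`, `2p^a`: if `(ℤ/n)ˣ` is
# cyclic and `n ≥ 3`, the real cyclotomic unit `(ζ^g − ζ^{−g})/(ζ − ζ^{−1})` (`g` a generator) has norm `−1`

research route conditional on HC_CM; not a corollary; Q11.4-sentence-2 already refuted in dim ≥ 3.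

Ring 2, WEIL-TYPE FAMILY-COVERAGE CENSUS (`HOME/WEIL-FAMILY-COVERAGE.md` `## b01`, block b01.45; owner ring2-b01), part 72
of the `Ring2WeilCoverage*` series.  Parts 66–68 proved THEOREM L (i): NO unit of `ℚ(ζₙ)⁺` has norm `−1` unless
`n ∈ {2^a, p^a, 2p^a}`.  This file proves the converse at the levels `n ≥ 3` with CYCLIC `(ℤ/n)ˣ` — by Gauss exactly
`n = 4`, `n = p^a` and `n = 2p^a` (`p` an odd prime, `a ≥ 1`; Mathlib `ZMod.isCyclic_units_iff`):

Let `g` generate `(ℤ/n)ˣ`, of order `φ(n) = 2d`; then `g^d = −1`.  Put `s(k) = ζ^k − ζ^{−k}` (so `σ_t s(k) = s(tk)`,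
`s(k)^ρ = −s(k)`, `s(−k) = −s(k)`) and `ξ = s(g)/s(1) = ζ^{1−g}(ζ^{2g} − 1)/(ζ² − 1)`: a REAL UNIT of `ℤ[ζ]` (a
cyclotomic unit: `ζ²` is a primitive root of order `n` or `n/2 ≥ 2` and `g` is prime to it).  The powers
`T = {g^i : 0 ≤ i < d}` form a half-system of `(ℤ/n)ˣ` modulo `±1` (part 71), so by part 71
`N_{K⁺/ℚ}(ξ) = ∏_{i<d} σ_{g^i}(ξ) = ∏_{i<d} s(g^{i+1})/s(g^i) = s(g^d)/s(1) = s(−1)/s(1) = −1`.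

* §1 `exists_generator_pow_eq_neg_one` — a generator `g` of a cyclic `(ℤ/n)ˣ`, `n ≥ 3`, has order `2d = φ(n)` and
  `g^d = −1`; hence `{g^i : i < d}` is a CM type set (`isCMTypeSet_powers_of_generator`).
* §2 **`exists_units_norm_eq_neg_one_of_isCyclic`** — THE THEOREM: `(ℤ/n)ˣ` cyclic, `n ≥ 3` ⟹ some unit of
  `𝓞 ℚ(ζₙ)⁺` has norm `−1`; corollaries `exists_units_norm_eq_neg_one_of_prime_pow` (`n = p^a`),
  `…_of_two_mul_prime_pow` (`n = 2p^a`), `…_four` (`n = 4`), and the negated census hypothesis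
  `not_forall_norm_pos_of_isCyclic` (`¬ hN`).

With part 73 (`n = 2^a`, Hasse's unit) and parts 67/68 this completes the DICHOTOMY: for `n ≥ 3`, `ℚ(ζₙ)⁺` has a
unit of norm `−1` iff `n ∈ {2^a, p^a, 2p^a}` ([Garbanati1976UnitsNormMinusOne] for general real abelian fields).

HONEST FRAMING: elementary algebraic number theory (cyclotomic units, `Gal(ℚ(ζₙ)/ℚ) = (ℤ/n)ˣ`, primitive roots);
nothing here is a statement about Hodge classes, `W_K`, general members or HC; `HC_CM` is used nowhere.  No `def`, no
named fact, no `sorry`.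

References: [cite: Washington1997, §8.1, Lemma 8.1 (p. 144)] (the real cyclotomic units
`ξ_a = ζ^{(1−a)/2}(1 − ζ^a)/(1 − ζ)`); [cite: DummitDummitKisilevsky2019, §2 (arXiv pp. 5–7)] (the units
`(ζ^a − ζ^{−a})/(ζ − ζ^{−1})` and their signatures); [cite: Garbanati1976UnitsNormMinusOne] (statement for real
abelian fields); census b01.44 (E) «NOT CLAIMED: the converse at prime-power levels», b01.45.
-/

noncomputable section

open scoped Classical nonZeroDivisors NumberField
open NumberField Module Finset

namespace Summit.HodgeConjecture.Ring2WeilCoverage.RealUnitNormCyclicLevels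

open Literature.AlgebraicGeometry.HodgeTheory (IsCMTypeSet)
open Summit.HodgeConjecture.Ring2WeilCoverage.RealUnitNormReduction (exists_aut_apply_eq_pow)
open Summit.HodgeConjecture.Ring2WeilCoverage.RealUnitNormHalfSystems

/-! ### §1 Generators of a cyclic `(ℤ/n)ˣ`: `g^{φ(n)/2} = −1`, and the half-system of powers -/

section Generator

variable {n : ℕ} [NeZero n]

/-- **A generator `g` of a cyclic `(ℤ/n)ˣ`, `n ≥ 3`, has order `2d = φ(n)` and `g^d = −1`**: `−1 = g^k` for some
`k < 2d`, and `g^{2k} = 1` forces `k ∈ {0, d}`; `k = 0` would give `−1 = 1`, impossible for `n ≥ 3`.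
research route conditional on HC_CM; not a corollary; Q11.4-sentence-2 already refuted in dim ≥ 3. [folklore] -/
theorem exists_generator_pow_eq_neg_one (hn : 2 < n) (hcyc : IsCyclic (ZMod n)ˣ) :
    ∃ γ : (ZMod n)ˣ, ∃ d : ℕ, 2 * d = Nat.totient n ∧ orderOf γ = 2 * d ∧ γ ^ d = -1 := by
  haveI : Fact (2 < n) := ⟨hn⟩
  obtain ⟨γ, hγ⟩ := isCyclic_iff_exists_orderOf_eq_natCard.mp hcyc
  have hcard : Nat.card (ZMod n)ˣ = Nat.totient n := by
    rw [Nat.card_eq_fintype_card, ZMod.card_units_eq_totient]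
  obtain ⟨d, hd⟩ := Nat.totient_even hn
  have hd2 : 2 * d = Nat.totient n := by omega
  have hordγ : orderOf γ = 2 * d := by rw [hγ, hcard, hd2]
  have hdpos : 0 < d := by
    have := Nat.totient_pos.mpr (NeZero.pos n)
    omega
  refine ⟨γ, d, hd2, hordγ, ?_⟩
  -- `-1` is a power of `γ`
  have htop : Subgroup.zpowers γ = ⊤ := by
    rw [← Subgroup.card_eq_iff_eq_top, Nat.card_zpowers, hγ]
  have hmem : (-1 : (ZMod n)ˣ) ∈ Submonoid.powers γ := by
    rw [mem_powers_iff_mem_zpowers, htop]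
    exact Subgroup.mem_top _
  obtain ⟨k, hk⟩ := (Submonoid.mem_powers_iff _ _).mp hmem
  rw [← pow_mod_orderOf, hordγ] at hk
  have hr : k % (2 * d) < 2 * d := Nat.mod_lt _ (by omega)
  have h2 : γ ^ (2 * (k % (2 * d))) = 1 := by
    rw [mul_comm, pow_mul, hk, neg_one_sq]
  have hdvd : orderOf γ ∣ 2 * (k % (2 * d)) := orderOf_dvd_of_pow_eq_one h2
  rw [hordγ] at hdvd
  obtain ⟨c, hc⟩ := Nat.dvd_of_mul_dvd_mul_left two_pos hdvd
  have hc2 : c < 2 := by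
    by_contra h
    push Not at h
    have : d * 2 ≤ d * c := Nat.mul_le_mul_left d h
    omega
  interval_cases c
  · -- `k % 2d = 0`: `-1 = 1`, impossible
    exfalso
    rw [mul_zero] at hc
    rw [hc, pow_zero] at hk
    have h1 := congrArg Units.val hk
    rw [Units.val_one, Units.val_neg, Units.val_one] at h1
    exact ZMod.neg_one_ne_one h1.symm
  · rw [mul_one] at hc
    rw [hc] at hk
    exact hk

/-- **The half-system of powers of a generator**: with `γ, d` as in `exists_generator_pow_eq_neg_one`, the residues
`γ^0, …, γ^{d−1}` form a CM type set mod `n` (`γ^i = −γ^j = γ^{d+j}` is impossible for `i, j < d`).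
research route conditional on HC_CM; not a corollary; Q11.4-sentence-2 already refuted in dim ≥ 3. [folklore] -/
theorem isCMTypeSet_powers_of_generator {γ : (ZMod n)ˣ} {d : ℕ} (hd2 : 2 * d = Nat.totient n)
    (hordγ : orderOf γ = 2 * d) (hγd : γ ^ d = -1) :
    IsCMTypeSet n ((Finset.range d).image fun i => ((γ ^ i : (ZMod n)ˣ) : ZMod n)) := by
  refine isCMTypeSet_image_pow γ hd2 (by rw [hordγ]; omega) fun i hi j hj h => ?_
  have h' : γ ^ i = γ ^ (d + j) := by
    apply Units.ext
    rw [pow_add, hγd, Units.val_mul, Units.val_neg, Units.val_one, neg_one_mul]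
    exact h
  rw [pow_inj_mod, hordγ, Nat.mod_eq_of_lt (by omega), Nat.mod_eq_of_lt (by omega)] at h'
  omega

end Generator

/-! ### §2 THE THEOREM at the cyclic levels -/

section Cyclic

variable {K : Type} [Field K] [NumberField K] [IsCMField K] {n : ℕ} [NeZero n] {ζ : K}

/-- **CONVERSE OF THEOREM L (i) AT THE CYCLIC LEVELS.**  Let `K = ℚ(ζₙ)` with `n ≥ 3` and `(ℤ/n)ˣ` CYCLIC (i.e.
`n = 4`, `p^a` or `2p^a` for an odd prime `p`).  Then `𝓞 K⁺ = 𝓞 ℚ(ζₙ)⁺` has a unit of norm `−1`: for a generator `g`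
of `(ℤ/n)ˣ` the real cyclotomic unit `ξ = (ζ^g − ζ^{−g})/(ζ − ζ^{−1})` has
`N_{K⁺/ℚ}(ξ) = ∏_{i < φ(n)/2} σ_{g^i}(ξ) = (ζ^{g^{φ/2}} − ζ^{−g^{φ/2}})/(ζ − ζ^{−1}) = −1` (telescoping; `g^{φ/2} = −1`).
research route conditional on HC_CM; not a corollary; Q11.4-sentence-2 already refuted in dim ≥ 3. [cite: Washington1997, §8.1, Lemma 8.1 (p. 144)] [cite: DummitDummitKisilevsky2019, §2 (arXiv p. 5)] -/
theorem exists_units_norm_eq_neg_one_of_isCyclic [IsCyclotomicExtension {n} ℚ K] (hζ : IsPrimitiveRoot ζ n)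
    (hn : 2 < n) (hcyc : IsCyclic (ZMod n)ˣ) :
    ∃ v : (𝓞 (maximalRealSubfield K))ˣ,
      Algebra.norm ℚ (((v : 𝓞 (maximalRealSubfield K)) : maximalRealSubfield K)) = -1 := by
  haveI : Fact (1 < n) := ⟨by omega⟩
  obtain ⟨γ, d, hd2, hordγ, hγd⟩ := exists_generator_pow_eq_neg_one hn hcyc
  have hT := isCMTypeSet_powers_of_generator hd2 hordγ hγd
  -- automorphisms `σ_t : ζ ↦ ζ^t`
  have hσ : ∀ t : ZMod n, ∃ σ : K ≃ₐ[ℚ] K, t.val.Coprime n → σ ζ = ζ ^ t.val := fun t => by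
    by_cases ht : t.val.Coprime n
    · obtain ⟨σ, hσ⟩ := exists_aut_apply_eq_pow hζ t ht
      exact ⟨σ, fun _ => hσ⟩
    · exact ⟨AlgEquiv.refl, fun h => absurd h ht⟩
  choose σf hσf using hσ
  -- the integer `U = ζ^e · (1 + ζ² + ⋯ + ζ^{2(g−1)})`, `e ≡ 1 − g`
  set g : ℕ := ((γ : (ZMod n)ˣ) : ZMod n).val with hg
  have hgcop : g.Coprime n := ZMod.val_coe_unit_coprime γ
  set ζi : 𝓞 K := hζ.toInteger with hζi
  have hζiprim : IsPrimitiveRoot ζi n := hζ.toInteger_isPrimitiveRoot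
  set n' : ℕ := orderOf (ζi ^ 2) with hn'
  have hζ2 : IsPrimitiveRoot (ζi ^ 2) n' := IsPrimitiveRoot.orderOf (ζi ^ 2)
  have hn'dvd : n' ∣ n := orderOf_dvd_of_pow_eq_one
    (by rw [← pow_mul, mul_comm, pow_mul, hζiprim.pow_eq_one, one_pow])
  have hn'2 : 2 ≤ n' := by
    have h0 : n' ≠ 0 := fun h => NeZero.ne n (Nat.eq_zero_of_zero_dvd (h ▸ hn'dvd))
    have h1 : n' ≠ 1 := by
      intro h
      have h21 : ζi ^ 2 = 1 := by rw [← pow_one (ζi ^ 2), ← h, hn', pow_orderOf_eq_one]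
      have := Nat.le_of_dvd two_pos (hζiprim.dvd_of_pow_eq_one 2 h21)
      omega
    omega
  have hgcop' : g.Coprime n' := hgcop.coprime_dvd_right hn'dvd
  set e : ℕ := (n - 1) * g + 1 with he
  set U : 𝓞 K := ζi ^ e * ∑ i ∈ Finset.range g, (ζi ^ 2) ^ i with hU
  have hUunit : IsUnit U :=
    ((hζiprim.isUnit (NeZero.ne n)).pow e).mul (hζ2.geom_sum_isUnit hn'2 hgcop')
  -- the sine quotients `s k = ζ^k − ζ^{−k}` in `K`
  have hζ0 : ζ ≠ 0 := hζ.ne_zero (NeZero.ne n)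
  set s : ℕ → K := fun k => ζ ^ k - (ζ ^ k)⁻¹ with hs
  have hs_mod : ∀ k k' : ℕ, k ≡ k' [MOD n] → s k = s k' := fun k k' h => by
    simp only [hs, pow_eq_pow_of_modEq hζ h]
  have hs_aut : ∀ (σ : K ≃ₐ[ℚ] K) (a k : ℕ), σ ζ = ζ ^ a → σ (s k) = s (a * k) := fun σ a k h => by
    simp only [hs, map_sub, map_inv₀, map_pow, h, pow_mul]
  have hs_add : ∀ k k' : ℕ, n ∣ k + k' → s k = -s k' := fun k k' h => by
    have h1 : ζ ^ k * ζ ^ k' = 1 := by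
      obtain ⟨c, hc⟩ := h
      rw [← pow_add, hc, pow_mul, hζ.pow_eq_one, one_pow]
    simp only [hs, eq_inv_of_mul_eq_one_left h1, inv_inv, neg_sub]
  have hs_ne : ∀ k : ℕ, k.Coprime n → s k ≠ 0 := fun k hk h => by
    have heq : ζ ^ k = (ζ ^ k)⁻¹ := sub_eq_zero.mp h
    have h2 : ζ ^ (2 * k) = 1 := by
      rw [two_mul, pow_add]
      nth_rw 2 [heq]
      exact mul_inv_cancel₀ (pow_ne_zero _ hζ0)
    have hdvd : n ∣ 2 := Nat.Coprime.dvd_of_dvd_mul_right hk.symm (hζ.dvd_of_pow_eq_one _ h2)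
    have := Nat.le_of_dvd two_pos hdvd
    omega
  have hs_conj : ∀ k : ℕ, IsCMField.complexConj K (s k) = -s k := fun k => by
    simp only [hs, map_sub, map_inv₀, map_pow, complexConj_eq_inv hζ, inv_pow, inv_inv, neg_sub]
  have hs1 : s 1 ≠ 0 := hs_ne 1 (Nat.coprime_one_left n)
  -- `(U : K) = s g / s 1`
  have hUK : ((U : 𝓞 K) : K) = s g / s 1 := by
    rw [eq_div_iff hs1]
    have hU' : ((U : 𝓞 K) : K) = ζ ^ e * ∑ i ∈ Finset.range g, (ζ ^ 2) ^ i := by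
      rw [hU]; push_cast; rfl
    have hgs : (∑ i ∈ Finset.range g, (ζ ^ 2) ^ i) * (ζ ^ 2 - 1) = (ζ ^ 2) ^ g - 1 := geom_sum_mul _ _
    have heg : ζ ^ e * ζ ^ g = ζ := by
      have h1 : e + g = n * g + 1 := by
        have : (n - 1) * g + g = n * g := by
          rw [Nat.sub_one_mul, Nat.sub_add_cancel (Nat.le_mul_of_pos_left g (NeZero.pos n))]
        omega
      rw [← pow_add, h1, pow_succ, pow_mul, hζ.pow_eq_one, one_pow, one_mul]
    have hs1' : s 1 = ζ⁻¹ * (ζ ^ 2 - 1) := by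
      rw [eq_comm, inv_mul_eq_iff_eq_mul₀ hζ0]
      show ζ ^ 2 - 1 = ζ * (ζ ^ 1 - (ζ ^ 1)⁻¹)
      rw [pow_one, mul_sub, mul_inv_cancel₀ hζ0]
      ring
    have hsg : s g = (ζ ^ g)⁻¹ * ((ζ ^ 2) ^ g - 1) := by
      rw [eq_comm, inv_mul_eq_iff_eq_mul₀ (pow_ne_zero g hζ0)]
      show (ζ ^ 2) ^ g - 1 = ζ ^ g * (ζ ^ g - (ζ ^ g)⁻¹)
      rw [mul_sub, mul_inv_cancel₀ (pow_ne_zero g hζ0), ← pow_mul, mul_comm 2 g, pow_mul]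
      ring
    have hinv : ζ ^ e * ζ⁻¹ = (ζ ^ g)⁻¹ := by
      rw [mul_inv_eq_iff_eq_mul₀ hζ0, eq_inv_mul_iff_mul_eq₀ (pow_ne_zero g hζ0), mul_comm]
      exact heg
    calc ((U : 𝓞 K) : K) * s 1 = ζ ^ e * ζ⁻¹ * ((∑ i ∈ Finset.range g, (ζ ^ 2) ^ i) * (ζ ^ 2 - 1)) := by
          rw [hU', hs1']; ring
      _ = s g := by rw [hgs, hinv, hsg]
  have hUreal : IsCMField.complexConj K ((U : 𝓞 K) : K) = U := by
    rw [hUK, map_div₀, hs_conj g, hs_conj 1, neg_div_neg_eq]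
  -- the telescoping product over `T = {γ^i : i < d}`
  set a : ℕ → ℕ := fun i => ((γ ^ i : (ZMod n)ˣ) : ZMod n).val with ha
  have ha_cop : ∀ i, (a i).Coprime n := fun i => ZMod.val_coe_unit_coprime _
  have ha0 : a 0 = 1 := by
    simp only [ha, pow_zero, Units.val_one, ZMod.val_one]
  have had : n ∣ a d + 1 := by
    have h1 : ((a d : ℕ) : ZMod n) = -1 := by
      simp only [ha, ZMod.natCast_zmod_val, hγd, Units.val_neg, Units.val_one]
    have h2 : ((a d + 1 : ℕ) : ZMod n) = 0 := by push_cast; rw [h1]; ring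
    exact (ZMod.natCast_eq_zero_iff _ _).mp h2
  have hprod : ∏ t ∈ (Finset.range d).image (fun i => ((γ ^ i : (ZMod n)ˣ) : ZMod n)),
      σf t ((U : 𝓞 K) : K) = -1 := by
    rw [Finset.prod_image (coe_pow_injOn γ (by rw [hordγ]; omega))]
    have hfac : ∀ i ∈ Finset.range d,
        σf ((γ ^ i : (ZMod n)ˣ) : ZMod n) ((U : 𝓞 K) : K) = s (a (i + 1)) / s (a i) := by
      intro i _
      rw [hUK, map_div₀, hs_aut _ (a i) g (hσf _ (ha_cop i)), hs_aut _ (a i) 1 (hσf _ (ha_cop i)), mul_one,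
        hs_mod _ _ (val_pow_succ_modEq γ i)]
    rw [Finset.prod_congr rfl hfac, prod_range_div_telescope (fun i => s (a i)) (fun i _ => hs_ne _ (ha_cop i)),
      ha0, hs_add (a d) 1 had, neg_div, div_self hs1]
  obtain ⟨v, -, hv⟩ := exists_units_norm_eq_neg_one_of_prod_aut hζ hT hσf hUunit hUreal hprod
  exact ⟨v, hv⟩

/-- **`n = p^a`, `p` an odd prime, `a ≥ 1`**: `ℚ(ζₙ)⁺` has a unit of norm `−1` (`(ℤ/p^a)ˣ` is cyclic, Mathlib
`ZMod.isCyclic_units_of_prime_pow`).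
research route conditional on HC_CM; not a corollary; Q11.4-sentence-2 already refuted in dim ≥ 3. [cite: Washington1997, §8.1, Lemma 8.1 (p. 144)] -/
theorem exists_units_norm_eq_neg_one_of_prime_pow [IsCyclotomicExtension {n} ℚ K] (hζ : IsPrimitiveRoot ζ n)
    {p a : ℕ} (hp : p.Prime) (hp2 : p ≠ 2) (ha : a ≠ 0) (hn : n = p ^ a) :
    ∃ v : (𝓞 (maximalRealSubfield K))ˣ,
      Algebra.norm ℚ (((v : 𝓞 (maximalRealSubfield K)) : maximalRealSubfield K)) = -1 := by
  refine exists_units_norm_eq_neg_one_of_isCyclic hζ ?_ (hn ▸ ZMod.isCyclic_units_of_prime_pow p hp hp2 a)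
  have h3 : 3 ≤ p ^ a :=
    calc 3 ≤ p := by have := hp.two_le; omega
      _ = p ^ 1 := (pow_one p).symm
      _ ≤ p ^ a := Nat.pow_le_pow_right hp.pos (Nat.one_le_iff_ne_zero.mpr ha)
  omega

/-- **`n = 2p^a`, `p` an odd prime, `a ≥ 1`**: `ℚ(ζₙ)⁺` has a unit of norm `−1` (`(ℤ/2p^a)ˣ ≅ (ℤ/p^a)ˣ` is cyclic).
research route conditional on HC_CM; not a corollary; Q11.4-sentence-2 already refuted in dim ≥ 3. [cite: Washington1997, §8.1, Lemma 8.1 (p. 144)] -/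
theorem exists_units_norm_eq_neg_one_of_two_mul_prime_pow [IsCyclotomicExtension {n} ℚ K]
    (hζ : IsPrimitiveRoot ζ n) {p a : ℕ} (hp : p.Prime) (hp2 : p ≠ 2) (ha : a ≠ 0) (hn : n = 2 * p ^ a) :
    ∃ v : (𝓞 (maximalRealSubfield K))ˣ,
      Algebra.norm ℚ (((v : 𝓞 (maximalRealSubfield K)) : maximalRealSubfield K)) = -1 := by
  have hodd : Odd (p ^ a) := (hp.odd_of_ne_two hp2).pow
  refine exists_units_norm_eq_neg_one_of_isCyclic hζ ?_
    (hn ▸ (ZMod.isCyclic_units_two_mul_iff_of_odd _ hodd).mpr (ZMod.isCyclic_units_of_prime_pow p hp hp2 a))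
  have h3 : 3 ≤ p ^ a :=
    calc 3 ≤ p := by have := hp.two_le; omega
      _ = p ^ 1 := (pow_one p).symm
      _ ≤ p ^ a := Nat.pow_le_pow_right hp.pos (Nat.one_le_iff_ne_zero.mpr ha)
  omega

/-- **`n = 4`**: `ℚ(i)⁺ = ℚ` has the unit `−1` of norm `−1` (the cyclic engine with `g = 3`, `ξ = −1`).
research route conditional on HC_CM; not a corollary; Q11.4-sentence-2 already refuted in dim ≥ 3. [folklore] -/
theorem exists_units_norm_eq_neg_one_four [IsCyclotomicExtension {4} ℚ K] (hζ : IsPrimitiveRoot ζ 4) :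
    ∃ v : (𝓞 (maximalRealSubfield K))ˣ,
      Algebra.norm ℚ (((v : 𝓞 (maximalRealSubfield K)) : maximalRealSubfield K)) = -1 :=
  exists_units_norm_eq_neg_one_of_isCyclic hζ (by norm_num) ZMod.isCyclic_units_four

/-- **`¬ hN` at the cyclic levels**: the census hypothesis «every unit of `𝓞 ℚ(ζₙ)⁺` has positive norm» (THEOREM L (i),
parts 2/7/48/53/55/60b) FAILS when `(ℤ/n)ˣ` is cyclic and `n ≥ 3`.
research route conditional on HC_CM; not a corollary; Q11.4-sentence-2 already refuted in dim ≥ 3. [cite: Garbanati1976UnitsNormMinusOne] -/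
theorem not_forall_norm_pos_of_isCyclic [IsCyclotomicExtension {n} ℚ K] (hζ : IsPrimitiveRoot ζ n) (hn : 2 < n)
    (hcyc : IsCyclic (ZMod n)ˣ) :
    ¬ ∀ v : (𝓞 (maximalRealSubfield K))ˣ,
      0 < Algebra.norm ℚ (((v : 𝓞 (maximalRealSubfield K)) : maximalRealSubfield K)) := by
  obtain ⟨v, hv⟩ := exists_units_norm_eq_neg_one_of_isCyclic hζ hn hcyc
  intro h
  have := h v
  rw [hv] at this
  norm_num at this

end Cyclic

end Summit.HodgeConjecture.Ring2WeilCoverage.RealUnitNormCyclicLevels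

end
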